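import Summits.CriticalPhenomena.CardyFormulaZ2.Theorems.CardyComplexConeEdgePrecompactUFRSBoxRing
import Summits.CriticalPhenomena.CardyFormulaZ2.Theorems.CardyComplexConeEdgePrecompactUFRSOneStrandDecay

/-!
# Two marked edges deep inside a ball: one arc of the rectangle datum lies in a larger ball
(line `qkz-strip-boundary-arm` of crux `CardyComplexCone.EdgePrecompact`, stmt-CriticalPhenomena-11387;
geometric input of the registered sub-goal S0 = `ufrs_junction_deepPair_le` of the per-scale
junction bound HJ-S, lead c5 wave 3; registered anchor `ufrs_rect_arcNear_of_markedNear`)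

**Theorem** (`ufrs_rect_arcNear_of_markedNear`). Let `F` be `ℤ²`-admissible Dobrushin data of the
open rectangle `(x₀, x₁) × (y₀, y₁)`, `z ∈ ℂ` and `ρ ≥ 0` with `2ρ + 8δ ≤` both sides (`δ = F.δ`).
If both marked (`A`–`B`) edges of `F` have their midpoints within `ρ` of `z`, then ALL sites of
the wired arc `F.zdArcA`, or all sites of the free arc `F.zdArcB`, lie within `10ρ + 22δ` of `z`.

This complements `ufrs_rect_boundaryMonochromatic` (`…UFRSRectMono.lean`: a ball avoiding the
marked midpoints at double radius meets one arc only), which cannot see across the junctions; here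
the whole boundary ring is needed. Proof: the discrete boundary is the set of sites on the four
sides of the lattice box `[i₀, i₀ + W] × [j₀, j₀ + H]` (`…UFRSRectLatticeBox.lean`), enumerated by
the ring `γ` of `…UFRSBoxRing.lean`; colour a site by "lies on `zdArcA`". Two consecutive ring
sites of different colours are lattice-adjacent boundary sites on different arcs, so they span a
marked edge (`dom_adj_iff_rect`), whose midpoint is within `ρ` of `z`: both are within
sup-distance `n₁ = ⌊ρ/δ⌋ + 2` lattice units of the lattice point `c = ⌊z/δ⌋` below `z`. By
`boxRing_far_sameSide_HJ`, of an `A`-site and a `B`-site one is within `5 n₁` lattice units of `c`,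
i.e. within `2δ(5n₁ + 1) ≤ 10ρ + 22δ` of `z`; so an `A`-site and a `B`-site cannot both be far.

References: S. Smirnov, C. R. Acad. Sci. Paris 333 (2001), §2 (discrete Dobrushin domains, arcs,
marked edges); D. Chelkak, S. Smirnov, Invent. Math. 189 (2012), §1.2 (discretisation conventions).
-/

namespace Summit.CriticalPhenomena.CardyFormulaZ2.Cruxes.EdgePrecompact.QkzStripBoundaryArm

open MeasureTheory Filter Set Metric
open scoped Topology BigOperators Pointwise
open Literature.Probability.LatticeModels Literature.Probability.Percolation
open Literature.Probability.RandomPlanarGeometry (DobrushinDomain)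
open Summit.CriticalPhenomena.CardyFormulaZ2.Theses.CardyComplexCone

noncomputable section

/-! ## Conversions between distances in the plane and sup-distances on the lattice -/

/-- A mesh point within `d` of `z` is within `⌊d/δ⌋ + 1` lattice units (each coordinate, both
signs, with one unit of slack downwards) of the lattice point `(⌊z.re/δ⌋, ⌊z.im/δ⌋)`. -/
theorem latticeSup_le_of_dist_le_HJ {δ d : ℝ} (hδ : 0 < δ) {v : Site 2} {z : ℂ} (h : dist (meshPoint δ v) z ≤ d) :
    v 0 - ⌊z.re / δ⌋ ≤ ⌊d / δ⌋ + 1 ∧ ⌊z.re / δ⌋ - v 0 ≤ ⌊d / δ⌋ + 1 ∧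
      v 1 - ⌊z.im / δ⌋ ≤ ⌊d / δ⌋ + 1 ∧ ⌊z.im / δ⌋ - v 1 ≤ ⌊d / δ⌋ + 1 := by
  rw [Complex.dist_eq] at h
  have hre : |δ * v 0 - z.re| ≤ d := by
    have h1 := Complex.abs_re_le_norm (meshPoint δ v - z)
    rw [Complex.sub_re, meshPoint_re] at h1; exact h1.trans h
  have him : |δ * v 1 - z.im| ≤ d := by
    have h1 := Complex.abs_im_le_norm (meshPoint δ v - z)
    rw [Complex.sub_im, meshPoint_im] at h1; exact h1.trans h
  have key : ∀ (k : ℤ) (x : ℝ), |δ * k - x| ≤ d → k - ⌊x / δ⌋ ≤ ⌊d / δ⌋ + 1 ∧ ⌊x / δ⌋ - k ≤ ⌊d / δ⌋ + 1 := by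
    intro k x hk
    obtain ⟨hk1, hk2⟩ := abs_le.1 hk
    have hf1 := Int.floor_le (x / δ)
    have hf2 := Int.lt_floor_add_one (x / δ)
    have hd2 := Int.lt_floor_add_one (d / δ)
    have e1 : (k : ℝ) ≤ x / δ + d / δ := by
      rw [← add_div, le_div_iff₀ hδ]; linarith
    have e2 : x / δ - d / δ ≤ k := by
      rw [← sub_div, div_le_iff₀ hδ]; linarith
    constructor
    · have : (k : ℝ) < (⌊x / δ⌋ : ℝ) + 1 + ((⌊d / δ⌋ : ℝ) + 1) := by linarith
      have : ((k - ⌊x / δ⌋ : ℤ) : ℝ) < ((⌊d / δ⌋ + 2 : ℤ) : ℝ) := by push_cast; linarith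
      have := Int.cast_lt.1 this
      omega
    · have : (⌊x / δ⌋ : ℝ) < k + ((⌊d / δ⌋ : ℝ) + 1) := by linarith
      have : ((⌊x / δ⌋ - k : ℤ) : ℝ) < ((⌊d / δ⌋ + 1 : ℤ) : ℝ) := by push_cast; linarith
      have := Int.cast_lt.1 this
      omega
  obtain ⟨h1, h2⟩ := key (v 0) z.re hre
  obtain ⟨h3, h4⟩ := key (v 1) z.im him
  exact ⟨h1, h2, h3, h4⟩

/-- Conversely, a site within `m` lattice units (each coordinate) of `(⌊z.re/δ⌋, ⌊z.im/δ⌋)` has its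
mesh point within `2δ(m + 1)` of `z`. -/
theorem dist_le_of_latticeSup_le_HJ {δ : ℝ} (hδ : 0 < δ) {v : Site 2} {z : ℂ} {m : ℤ}
    (h0 : v 0 - ⌊z.re / δ⌋ ≤ m ∧ ⌊z.re / δ⌋ - v 0 ≤ m) (h1 : v 1 - ⌊z.im / δ⌋ ≤ m ∧ ⌊z.im / δ⌋ - v 1 ≤ m) :
    dist (meshPoint δ v) z ≤ 2 * (δ * (m + 1)) := by
  have hm : (0 : ℤ) ≤ m := by omega
  have hT : 0 < δ * (m + 1) := by
    have : (0 : ℝ) ≤ m := by exact_mod_cast hm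
    positivity
  have key : ∀ (k : ℤ) (x : ℝ), k - ⌊x / δ⌋ ≤ m → ⌊x / δ⌋ - k ≤ m → |δ * k - x| ≤ δ * (m + 1) := by
    intro k x hk1 hk2
    have hf1 := Int.floor_le (x / δ)
    have hf2 := Int.lt_floor_add_one (x / δ)
    have hk1' : ((k : ℤ) : ℝ) - ⌊x / δ⌋ ≤ m := by exact_mod_cast hk1
    have hk2' : (⌊x / δ⌋ : ℝ) - k ≤ m := by exact_mod_cast hk2
    have hx : x = δ * (x / δ) := by field_simp
    rw [abs_le]
    constructor <;> nlinarith
  refine (dist_lt_two_mul_of_abs_le hT ?_ ?_).le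
  · rw [meshPoint_re]; exact key (v 0) z.re h0.1 h0.2
  · rw [meshPoint_im]; exact key (v 1) z.im h1.1 h1.2

/-- An endpoint of a pair of lattice-adjacent sites is within `δ` of its medial point
(coordinatewise within `δ/2`). -/
theorem dist_meshPoint_medialPoint_le_HJ {δ : ℝ} (hδ : 0 < δ) {p q : Site 2} (h : (zdGraph 2).Adj p q) :
    dist (meshPoint δ p) (medialPoint δ s(p, q)) ≤ δ := by
  have hT : (0 : ℝ) < δ / 2 := by positivity
  have h2 := dist_lt_two_mul_of_abs_le hT (m := meshPoint δ p) (z := medialPoint δ s(p, q)) ?_ ?_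
  · linarith
  · rw [medialPoint_mk, Complex.div_ofNat_re, Complex.add_re, meshPoint_re, meshPoint_re]
    rw [abs_le]
    rcases stepKind_of_adj h with ⟨h0, -⟩ | ⟨h0, -⟩ | ⟨-, h0⟩ | ⟨-, h0⟩
    · have : ((q 0 : ℤ) : ℝ) = p 0 + 1 := by exact_mod_cast h0
      constructor <;> nlinarith
    · have : ((p 0 : ℤ) : ℝ) = q 0 + 1 := by exact_mod_cast h0
      constructor <;> nlinarith
    · have : ((q 0 : ℤ) : ℝ) = p 0 := by exact_mod_cast h0
      constructor <;> nlinarith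
    · have : ((q 0 : ℤ) : ℝ) = p 0 := by exact_mod_cast h0
      constructor <;> nlinarith
  · rw [medialPoint_mk, Complex.div_ofNat_im, Complex.add_im, meshPoint_im, meshPoint_im]
    rw [abs_le]
    rcases stepKind_of_adj h with ⟨-, h1⟩ | ⟨-, h1⟩ | ⟨h1, -⟩ | ⟨h1, -⟩
    · have : ((q 1 : ℤ) : ℝ) = p 1 := by exact_mod_cast h1
      constructor <;> nlinarith
    · have : ((q 1 : ℤ) : ℝ) = p 1 := by exact_mod_cast h1
      constructor <;> nlinarith
    · have : ((q 1 : ℤ) : ℝ) = p 1 + 1 := by exact_mod_cast h1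
      constructor <;> nlinarith
    · have : ((p 1 : ℤ) : ℝ) = q 1 + 1 := by exact_mod_cast h1
      constructor <;> nlinarith

/-! ## The lattice box in integer coordinates -/

/-- **The lattice box and its sides in integer coordinates.** For `ℤ²`-admissible data of the open
rectangle, with `i₀ = ⌊x₀/δ⌋ + 1`, `j₀ = ⌊y₀/δ⌋ + 1`, `W = ⌈x₁/δ⌉ - 1 - i₀`, `H = ⌈y₁/δ⌉ - 1 - j₀`:
the mesh vertices are the sites of `[i₀, i₀ + W] × [j₀, j₀ + H]`, and the discrete boundary sites
are exactly those on the four sides. -/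
theorem box_coords_HJ {F : DiscreteDobrushin} {x₀ x₁ y₀ y₁ : ℝ} (hFΩ : F.Ω = Set.Ioo x₀ x₁ ×ℂ Set.Ioo y₀ y₁)
    (hF : F.IsZdAdmissible) :
    (∀ v : Site 2, v ∈ meshVertices F.Ω F.δ ↔
      ⌊x₀ / F.δ⌋ + 1 ≤ v 0 ∧ v 0 ≤ ⌈x₁ / F.δ⌉ - 1 ∧ ⌊y₀ / F.δ⌋ + 1 ≤ v 1 ∧ v 1 ≤ ⌈y₁ / F.δ⌉ - 1) ∧
    (∀ v : Site 2, v ∈ F.zdBoundary ↔ (⌊x₀ / F.δ⌋ + 1 ≤ v 0 ∧ v 0 ≤ ⌈x₁ / F.δ⌉ - 1 ∧ ⌊y₀ / F.δ⌋ + 1 ≤ v 1 ∧ v 1 ≤ ⌈y₁ / F.δ⌉ - 1) ∧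
      (v 0 = ⌊x₀ / F.δ⌋ + 1 ∨ v 0 = ⌈x₁ / F.δ⌉ - 1 ∨ v 1 = ⌊y₀ / F.δ⌋ + 1 ∨ v 1 = ⌈y₁ / F.δ⌉ - 1)) := by
  have hδ := hF.delta_pos
  have hbox : ∀ v : Site 2, v ∈ meshVertices F.Ω F.δ ↔
      ⌊x₀ / F.δ⌋ + 1 ≤ v 0 ∧ v 0 ≤ ⌈x₁ / F.δ⌉ - 1 ∧ ⌊y₀ / F.δ⌋ + 1 ≤ v 1 ∧ v 1 ≤ ⌈y₁ / F.δ⌉ - 1 := by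
    intro v
    rw [mem_meshVertices_rect' hFΩ]
    have e1 : x₀ < F.δ * v 0 ↔ ⌊x₀ / F.δ⌋ + 1 ≤ v 0 := by
      rw [Int.add_one_le_iff, Int.floor_lt, div_lt_iff₀ hδ, mul_comm]
    have e2 : F.δ * v 0 < x₁ ↔ v 0 ≤ ⌈x₁ / F.δ⌉ - 1 := by
      rw [Int.le_sub_one_iff, Int.lt_ceil, lt_div_iff₀ hδ, mul_comm]
    have e3 : y₀ < F.δ * v 1 ↔ ⌊y₀ / F.δ⌋ + 1 ≤ v 1 := by
      rw [Int.add_one_le_iff, Int.floor_lt, div_lt_iff₀ hδ, mul_comm]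
    have e4 : F.δ * v 1 < y₁ ↔ v 1 ≤ ⌈y₁ / F.δ⌉ - 1 := by
      rw [Int.le_sub_one_iff, Int.lt_ceil, lt_div_iff₀ hδ, mul_comm]
    rw [e1, e2, e3, e4]; tauto
  refine ⟨hbox, fun v => ⟨fun hv => ?_, fun ⟨hv, hside⟩ => ?_⟩⟩
  · have hvV : v ∈ meshVertices F.Ω F.δ := by
      rw [← meshDomain_eq_rect hF hFΩ]; exact F.zdBoundary_subset_meshDomain hv
    refine ⟨(hbox v).1 hvV, ?_⟩
    have hb := (hbox v).1 hvV
    rcases side_of_mem_zdBoundary hF hFΩ hv with (h | h) | (h | h)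
    · right; right; left
      have : (v 1 : ℝ) - 1 ≤ y₀ / F.δ := by rw [le_div_iff₀ hδ]; linarith
      have : v 1 - 1 ≤ ⌊y₀ / F.δ⌋ := Int.le_floor.2 (by exact_mod_cast this)
      omega
    · right; right; right
      have : y₁ / F.δ ≤ (v 1 : ℝ) + 1 := by rw [div_le_iff₀ hδ]; linarith
      have : ⌈y₁ / F.δ⌉ ≤ v 1 + 1 := Int.ceil_le.2 (by exact_mod_cast this)
      omega
    · left
      have : (v 0 : ℝ) - 1 ≤ x₀ / F.δ := by rw [le_div_iff₀ hδ]; linarith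
      have : v 0 - 1 ≤ ⌊x₀ / F.δ⌋ := Int.le_floor.2 (by exact_mod_cast this)
      omega
    · right; left
      have : x₁ / F.δ ≤ (v 0 : ℝ) + 1 := by rw [div_le_iff₀ hδ]; linarith
      have : ⌈x₁ / F.δ⌉ ≤ v 0 + 1 := Int.ceil_le.2 (by exact_mod_cast this)
      omega
  · refine mem_zdBoundary_of_side hF hFΩ ((hbox v).2 hv) ?_
    have hf1 := Int.floor_le (x₀ / F.δ)
    have hf2 := Int.floor_le (y₀ / F.δ)
    have hc1 := Int.le_ceil (x₁ / F.δ)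
    have hc2 := Int.le_ceil (y₁ / F.δ)
    rcases hside with h | h | h | h
    · right; left
      have e : ((v 0 : ℤ) : ℝ) = (⌊x₀ / F.δ⌋ : ℝ) + 1 := by exact_mod_cast h
      have : (⌊x₀ / F.δ⌋ : ℝ) * F.δ ≤ x₀ := by rwa [← le_div_iff₀ hδ]
      nlinarith
    · right; right
      have e : ((v 0 : ℤ) : ℝ) = (⌈x₁ / F.δ⌉ : ℝ) - 1 := by exact_mod_cast h
      have : x₁ ≤ (⌈x₁ / F.δ⌉ : ℝ) * F.δ := by rwa [← div_le_iff₀ hδ]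
      nlinarith
    · left; left
      have e : ((v 1 : ℤ) : ℝ) = (⌊y₀ / F.δ⌋ : ℝ) + 1 := by exact_mod_cast h
      have : (⌊y₀ / F.δ⌋ : ℝ) * F.δ ≤ y₀ := by rwa [← le_div_iff₀ hδ]
      nlinarith
    · left; right
      have e : ((v 1 : ℤ) : ℝ) = (⌈y₁ / F.δ⌉ : ℝ) - 1 := by exact_mod_cast h
      have : y₁ ≤ (⌈y₁ / F.δ⌉ : ℝ) * F.δ := by rwa [← div_le_iff₀ hδ]
      nlinarith

/-! ## The registered statement -/

/-- **Marked edges deep inside a ball ⇒ one arc inside a larger ball** (registered anchor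
`ufrs_rect_arcNear_of_markedNear` of stmt-CriticalPhenomena-11387, the geometric input of S0).
See the module docstring. -/
theorem ufrs_rect_arcNear_of_markedNear : ∀ (F : DiscreteDobrushin) (x₀ x₁ y₀ y₁ : ℝ), x₀ < x₁ → y₀ < y₁ → F.Ω = Set.Ioo x₀ x₁ ×ℂ Set.Ioo y₀ y₁ → F.IsZdAdmissible → ∀ (z : ℂ) (ρ : ℝ), 0 ≤ ρ → 2 * ρ + 8 * F.δ ≤ min (x₁ - x₀) (y₁ - y₀) → (∀ e ∈ F.zdABEdges, dist (medialPoint F.δ e) z ≤ ρ) → (∀ x ∈ F.zdArcA, dist (meshPoint F.δ x) z ≤ 10 * ρ + 22 * F.δ) ∨ (∀ x ∈ F.zdArcB, dist (meshPoint F.δ x) z ≤ 10 * ρ + 22 * F.δ) := by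
  intro F x₀ x₁ y₀ y₁ hx hy hFΩ hF z ρ hρ hsmall hmarked
  classical
  have hδ := hF.delta_pos
  set δ := F.δ with hδdef
  obtain ⟨hbox, hbdy⟩ := box_coords_HJ hFΩ hF
  -- the box
  set i₀ : ℤ := ⌊x₀ / δ⌋ + 1 with hi₀
  set j₀ : ℤ := ⌊y₀ / δ⌋ + 1 with hj₀
  set W : ℤ := ⌈x₁ / δ⌉ - 1 - i₀ with hWdef
  set H : ℤ := ⌈y₁ / δ⌉ - 1 - j₀ with hHdef
  set n₁ : ℤ := ⌊ρ / δ⌋ + 2 with hn₁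
  have hn₁0 : 0 ≤ n₁ := by
    have : 0 ≤ ⌊ρ / δ⌋ := Int.floor_nonneg.2 (by positivity)
    omega
  have hsides : 2 * n₁ < W ∧ 2 * n₁ < H := by
    have h1 := Int.floor_le (x₀ / δ)
    have h2 := Int.le_ceil (x₁ / δ)
    have h3 := Int.floor_le (y₀ / δ)
    have h4 := Int.le_ceil (y₁ / δ)
    have h5 := Int.floor_le (ρ / δ)
    have hx' := min_le_left (x₁ - x₀) (y₁ - y₀)
    have hy' := min_le_right (x₁ - x₀) (y₁ - y₀)
    have e1 : x₁ / δ - x₀ / δ = (x₁ - x₀) / δ := by ring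
    have e2 : y₁ / δ - y₀ / δ = (y₁ - y₀) / δ := by ring
    have k1 : (2 * ρ + 8 * δ) / δ ≤ (x₁ - x₀) / δ := div_le_div_of_nonneg_right (hsmall.trans hx') hδ.le
    have k2 : (2 * ρ + 8 * δ) / δ ≤ (y₁ - y₀) / δ := div_le_div_of_nonneg_right (hsmall.trans hy') hδ.le
    have k3 : (2 * ρ + 8 * δ) / δ = 2 * (ρ / δ) + 8 := by field_simp
    constructor
    · have : ((2 * n₁ : ℤ) : ℝ) < ((W : ℤ) : ℝ) := by
        rw [hWdef, hi₀, hn₁]; push_cast; linarith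
      exact_mod_cast this
    · have : ((2 * n₁ : ℤ) : ℝ) < ((H : ℤ) : ℝ) := by
        rw [hHdef, hj₀, hn₁]; push_cast; linarith
      exact_mod_cast this
  have hW : 0 < W := by omega
  have hH : 0 < H := by omega
  -- the ring
  set γ : ℤ → Site 2 := fun s => if s ≤ W then ![i₀ + s, j₀] else if s ≤ W + H then ![i₀ + W, j₀ + (s - W)]
      else if s ≤ 2 * W + H then ![i₀ + W - (s - W - H), j₀ + H] else ![i₀, j₀ + H - (s - 2 * W - H)] with hγdef
  have hγ : ∀ s : ℤ, γ s = if s ≤ W then ![i₀ + s, j₀] else if s ≤ W + H then ![i₀ + W, j₀ + (s - W)]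
      else if s ≤ 2 * W + H then ![i₀ + W - (s - W - H), j₀ + H] else ![i₀, j₀ + H - (s - 2 * W - H)] := fun s => rfl
  have hiW : i₀ + W = ⌈x₁ / δ⌉ - 1 := by omega
  have hjH : j₀ + H = ⌈y₁ / δ⌉ - 1 := by omega
  -- ring sites are boundary sites
  have hγbdy : ∀ s : ℤ, 0 ≤ s → s ≤ 2 * W + 2 * H → γ s ∈ F.zdBoundary := by
    intro s hs0 hsP
    obtain ⟨h1, h2⟩ := ring_mem_box_HJ hγ hW hH hs0 hsP
    rw [hiW, hjH] at h1 h2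
    exact (hbdy _).2 ⟨h1, h2⟩
  -- the centre and the colour-change hypothesis
  set c : Site 2 := ![⌊z.re / δ⌋, ⌊z.im / δ⌋] with hc
  have hflip : ∀ s : ℤ, 0 ≤ s → s < 2 * W + 2 * H → (γ s ∈ F.zdArcA ↔ ¬ γ (s + 1) ∈ F.zdArcA) →
      (γ s 0 - c 0 ≤ n₁ ∧ c 0 - γ s 0 ≤ n₁ ∧ γ s 1 - c 1 ≤ n₁ ∧ c 1 - γ s 1 ≤ n₁) := by
    intro s hs0 hsP hch
    have hadj := ring_adj_HJ hγ hW hH hs0 hsP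
    have hp := hγbdy s hs0 hsP.le
    have hq := hγbdy (s + 1) (by omega) (by omega)
    have hpV : γ s ∈ meshVertices F.Ω F.δ := by
      rw [← meshDomain_eq_rect hF hFΩ]; exact F.zdBoundary_subset_meshDomain hp
    have hqV : γ (s + 1) ∈ meshVertices F.Ω F.δ := by
      rw [← meshDomain_eq_rect hF hFΩ]; exact F.zdBoundary_subset_meshDomain hq
    have hedge : s(γ s, γ (s + 1)) ∈ (discreteDomainGraph F.Ω F.δ).edgeSet :=
      (SimpleGraph.mem_edgeSet _).2 ((dom_adj_iff_rect hF hFΩ).2 ⟨hadj, hpV, hqV⟩)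
    have hAB : s(γ s, γ (s + 1)) ∈ F.zdABEdges := by
      have hpAB := hF.zdBoundary_subset hp
      have hqAB := hF.zdBoundary_subset hq
      by_cases hpA : γ s ∈ F.zdArcA
      · have hqB : γ (s + 1) ∈ F.zdArcB := hqAB.resolve_left (hch.1 hpA)
        exact ⟨hedge, ⟨_, Sym2.mem_mk_left _ _, hpA⟩, ⟨_, Sym2.mem_mk_right _ _, hqB⟩⟩
      · have hpB : γ s ∈ F.zdArcB := hpAB.resolve_left hpA
        have hqA : γ (s + 1) ∈ F.zdArcA := by by_contra h'; exact hpA (hch.2 h')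
        exact ⟨hedge, ⟨_, Sym2.mem_mk_right _ _, hqA⟩, ⟨_, Sym2.mem_mk_left _ _, hpB⟩⟩
    have hm := hmarked _ hAB
    have hdp : dist (meshPoint δ (γ s)) z ≤ ρ + δ := by
      linarith [dist_triangle (meshPoint δ (γ s)) (medialPoint δ s(γ s, γ (s + 1))) z,
        dist_meshPoint_medialPoint_le_HJ hδ hadj]
    have h4 := latticeSup_le_of_dist_le_HJ hδ hdp
    have hfl : ⌊(ρ + δ) / δ⌋ = ⌊ρ / δ⌋ + 1 := by
      rw [show (ρ + δ) / δ = ρ / δ + 1 by field_simp, Int.floor_add_one]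
    rw [hfl] at h4
    simp only [hc, Matrix.cons_val_zero, Matrix.cons_val_one]
    omega
  -- the contradiction
  by_contra hcon
  rw [not_or] at hcon
  obtain ⟨hA, hB⟩ := hcon
  push Not at hA hB
  obtain ⟨a', ha'A, ha'far⟩ := hA
  obtain ⟨b', hb'B, hb'far⟩ := hB
  obtain ⟨hba, hsa⟩ := (hbdy a').1 (F.zdArcA_subset_zdBoundary ha'A)
  obtain ⟨hbb, hsb⟩ := (hbdy b').1 (F.zdArcB_subset_zdBoundary hb'B)
  rw [← hiW, ← hjH] at hba hsa hbb hsb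
  obtain ⟨sa, hsa0, hsaP, hγa⟩ := ring_cover_HJ hγ hW hH hba hsa
  obtain ⟨sb, hsb0, hsbP, hγb⟩ := ring_cover_HJ hγ hW hH hbb hsb
  have hcol : γ sa ∈ F.zdArcA ↔ ¬ γ sb ∈ F.zdArcA := by
    rw [hγa, hγb]
    exact ⟨fun _ hbA => Set.disjoint_left.1 hF.disjoint hbA hb'B, fun _ => ha'A⟩
  have key := boxRing_far_sameSide_HJ γ i₀ j₀ W H (· ∈ F.zdArcA) c n₁ sa sb hγ hW hH hn₁0 hsides.1 hsides.2
    hflip hsa0 hsaP hsb0 hsbP hcol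
  have hbound : 2 * (δ * ((5 * n₁ : ℤ) + 1)) ≤ 10 * ρ + 22 * δ := by
    have h5 := Int.floor_le (ρ / δ)
    rw [hn₁]; push_cast
    have : δ * (ρ / δ) = ρ := by field_simp
    nlinarith
  rcases key with h | h
  · rw [hγa] at h
    simp only [hc, Matrix.cons_val_zero, Matrix.cons_val_one] at h
    have := dist_le_of_latticeSup_le_HJ hδ (z := z) (v := a') (m := 5 * n₁) ⟨h.1, h.2.1⟩ ⟨h.2.2.1, h.2.2.2⟩
    exact absurd (this.trans hbound) (not_le.2 ha'far)
  · rw [hγb] at h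
    simp only [hc, Matrix.cons_val_zero, Matrix.cons_val_one] at h
    have := dist_le_of_latticeSup_le_HJ hδ (z := z) (v := b') (m := 5 * n₁) ⟨h.1, h.2.1⟩ ⟨h.2.2.1, h.2.2.2⟩
    exact absurd (this.trans hbound) (not_le.2 hb'far)

end

end Summit.CriticalPhenomena.CardyFormulaZ2.Cruxes.EdgePrecompact.QkzStripBoundaryArm
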